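import Mathlib.Analysis.SpecialFunctions.Pow.Real
import Mathlib.Analysis.SpecialFunctions.Log.Base
import Mathlib.Analysis.SpecialFunctions.Pow.Asymptotics
import Mathlib.Analysis.Asymptotics.SpecificAsymptotics
import Mathlib.Analysis.Complex.ExponentialBounds
import Mathlib.Data.Nat.Log
import Mathlib.Data.Nat.Sqrt
import Mathlib.Data.Nat.Choose.Basic
import HarnessLib

/-!
# Elementary asymptotics for the locality circuit (towards `Locality_holds`)

Arithmetic lemmas, in `ℕ` with one excursion to `Real.log`, used to show that the kernelization
circuit of `LocalityCircuit.lean` has size `≤ ⌈m^{1+ε}⌉` for every fixed `ε = 1/(d+1)` and all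
large `n` (Chen–Hirahara–Oliveira–Pich–Rajgopal–Santhanam, Prop. 50 (E1^𝒪): size
`m^{1+ε_d}`, `ε_d → 0`). With `ℓ = log₂ n + 1` the circuit has size `n² · 2^{O_C(log ℓ · √ℓ)}`,
and `log ℓ · √ℓ = o(ℓ)`:

* `eventually_sq_log_le` — `(c (log₂ ℓ + 1) + 1)² ≤ ℓ` for large `ℓ` (from
  `Real.isLittleO_pow_log_id_atTop`);
* `eventually_log_mul_sqrt_le` — `c (log₂ ℓ + 1)(√ℓ + 1) + 1 ≤ ℓ` for large `ℓ`;
* `eventually_pow_le_two_pow` — `c ℓ^C ≤ 2^(ℓ-1)` for large `ℓ`;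
* `tendsto_log_two_succ` — `log₂ n + 1 → ∞`;
* `le_ceil_choose_two_rpow` — if `S ≤ n² 2^q`, `3 ≤ n` and `(d+1)(q+2) ≤ log₂ n` then
  `S ≤ ⌈(n choose 2)^{1 + 1/(d+1)}⌉₊`.

Everything is proved; nothing here is specific to circuits.
-/

namespace Literature.Barriers.PneNP.Locality

open Filter Asymptotics

/-- `Nat.log 2 ℓ ≤ 2 log ℓ` (natural logarithm), for `ℓ ≥ 1`. [folklore] -/
theorem natLog_two_le_two_mul_log {ℓ : ℕ} (hℓ : 1 ≤ ℓ) : (Nat.log 2 ℓ : ℝ) ≤ 2 * Real.log ℓ := by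
  have h2 : (2 : ℝ) ^ (Nat.log 2 ℓ) ≤ ℓ := by exact_mod_cast Nat.pow_log_le_self 2 (by omega)
  have hlog := Real.log_le_log (by positivity) h2
  rw [Real.log_pow] at hlog
  have hln2 : (1 : ℝ) / 2 ≤ Real.log 2 := by
    have := Real.log_two_gt_d9; norm_num at this ⊢; linarith
  have h0 : (0 : ℝ) ≤ Nat.log 2 ℓ := Nat.cast_nonneg _
  nlinarith

/-- `(c (log₂ ℓ + 1) + 1)² ≤ ℓ` for all large `ℓ` (since `(log ℓ)² = o(ℓ)`). [folklore] -/
theorem eventually_sq_log_le (c : ℕ) : ∀ᶠ ℓ : ℕ in atTop, (c * (Nat.log 2 ℓ + 1) + 1) ^ 2 ≤ ℓ := by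
  -- real bound: `(4c+2)² (log ℓ)² ≤ ℓ` eventually, and `c (log₂ ℓ + 1) + 1 ≤ (4c + 2) log ℓ`
  -- for `ℓ ≥ 3`
  have hlo := (Real.isLittleO_pow_log_id_atTop (n := 2)).def
    (show (0 : ℝ) < 1 / ((4 * c + 2 : ℝ) ^ 2) by positivity)
  have hnat := tendsto_natCast_atTop_atTop.eventually hlo
  filter_upwards [hnat, eventually_ge_atTop 3] with ℓ hℓ hℓ3
  have hℓpos : (0 : ℝ) < ℓ := by exact_mod_cast (show 0 < ℓ by omega)
  rw [Real.norm_of_nonneg (by positivity), id, Real.norm_of_nonneg hℓpos.le] at hℓ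
  have hlog1 : 1 ≤ Real.log ℓ := by
    rw [← Real.log_exp 1]
    refine Real.log_le_log (Real.exp_pos 1) ?_
    have := Real.exp_one_lt_d9
    have h3 : (3 : ℝ) ≤ ℓ := by exact_mod_cast hℓ3
    linarith
  have hA : (c * (Nat.log 2 ℓ + 1) + 1 : ℝ) ≤ (4 * c + 2) * Real.log ℓ := by
    have := natLog_two_le_two_mul_log (ℓ := ℓ) (by omega)
    have hc : (0 : ℝ) ≤ c := Nat.cast_nonneg _
    nlinarith
  have hB : ((4 * c + 2) * Real.log ℓ) ^ 2 ≤ ℓ := by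
    rw [mul_pow]
    have h := mul_le_mul_of_nonneg_left hℓ (show (0 : ℝ) ≤ (4 * c + 2 : ℝ) ^ 2 by positivity)
    rwa [← mul_assoc, mul_one_div_cancel (by positivity), one_mul] at h
  have h0 : (0 : ℝ) ≤ c * (Nat.log 2 ℓ + 1) + 1 := by positivity
  have : ((c * (Nat.log 2 ℓ + 1) + 1 : ℕ) : ℝ) ^ 2 ≤ ℓ := by
    push_cast
    exact (pow_le_pow_left₀ h0 hA 2).trans hB
  exact_mod_cast this

/-- `c (log₂ ℓ + 1) (√ℓ + 1) + 1 ≤ ℓ` for all large `ℓ`. [folklore] -/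
theorem eventually_log_mul_sqrt_le (c : ℕ) :
    ∀ᶠ ℓ : ℕ in atTop, c * (Nat.log 2 ℓ + 1) * (Nat.sqrt ℓ + 1) + 1 ≤ ℓ := by
  filter_upwards [eventually_sq_log_le (2 * c)] with ℓ hℓ
  set L := Nat.log 2 ℓ + 1
  set t := Nat.sqrt ℓ
  -- `2cL + 1 ≤ t` and `t² ≤ ℓ`
  have ht : 2 * c * L + 1 ≤ t := Nat.le_sqrt.2 (by simpa [sq] using hℓ)
  have htt : t * t ≤ ℓ := Nat.sqrt_le ℓ
  have : c * L * (t + 1) + 1 ≤ t * t := by nlinarith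
  exact this.trans htt

/-- `c ℓ^C ≤ 2^(ℓ-1)` for all large `ℓ`. [folklore] -/
theorem eventually_pow_le_two_pow (c C : ℕ) : ∀ᶠ ℓ : ℕ in atTop, c * ℓ ^ C ≤ 2 ^ (ℓ - 1) := by
  filter_upwards [eventually_log_mul_sqrt_le (c + C), eventually_ge_atTop 1] with ℓ hℓ hℓ1
  set L := Nat.log 2 ℓ + 1
  have hℓL : ℓ < 2 ^ L := Nat.lt_pow_succ_log_self (by norm_num) ℓ
  have hc : c < 2 ^ c := Nat.lt_two_pow_self
  -- `c ℓ^C < 2^c · 2^{C L} = 2^{c + C L}` and `c + C L ≤ ℓ - 1`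
  have h1 : c * ℓ ^ C ≤ 2 ^ (c + L * C) := by
    rw [pow_add, pow_mul]
    exact Nat.mul_le_mul hc.le (Nat.pow_le_pow_left hℓL.le C)
  have hL : 1 ≤ L := Nat.succ_le_succ (Nat.zero_le _)
  have h3 : (c + C) * L ≤ (c + C) * L * (Nat.sqrt ℓ + 1) :=
    Nat.le_mul_of_pos_right _ (Nat.succ_pos _)
  have h4 : c + L * C ≤ (c + C) * L := by nlinarith
  have h2 : c + L * C ≤ ℓ - 1 := by omega
  exact h1.trans (Nat.pow_le_pow_right (by norm_num) h2)

/-- `log₂ n + 1 → ∞`. [folklore] -/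
theorem tendsto_log_two_succ : Tendsto (fun n : ℕ => Nat.log 2 n + 1) atTop atTop := by
  refine tendsto_atTop_atTop.2 fun L => ⟨2 ^ L, fun n hn => ?_⟩
  have : L ≤ Nat.log 2 n := Nat.le_log_of_pow_le (by norm_num) hn
  omega

/-- The parameter `k = ⌊(log₂ n)^C⌋` is at most `(log₂ n + 1)^C` (with `Nat.log`). [folklore] -/
theorem floor_logb_pow_le (n C : ℕ) : ⌊Real.logb 2 n ^ C⌋₊ ≤ (Nat.log 2 n + 1) ^ C := by
  rcases Nat.eq_zero_or_pos n with rfl | hn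
  · have h : Real.logb 2 ((0 : ℕ) : ℝ) ^ C ≤ (1 : ℝ) := by
      rw [Nat.cast_zero, Real.logb_zero]; exact pow_le_one₀ le_rfl zero_le_one
    calc ⌊Real.logb 2 ((0 : ℕ) : ℝ) ^ C⌋₊ ≤ ⌊(1 : ℝ)⌋₊ := Nat.floor_le_floor h
      _ = 1 := Nat.floor_one
      _ ≤ (Nat.log 2 0 + 1) ^ C := by simp
  have h0 : 0 ≤ Real.logb 2 n := Real.logb_nonneg (by norm_num) (by exact_mod_cast hn)
  have hlt : Real.logb 2 n < (Nat.log 2 n + 1 : ℕ) := by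
    rw [Real.logb_lt_iff_lt_rpow (by norm_num) (by exact_mod_cast hn), Real.rpow_natCast]
    exact_mod_cast Nat.lt_pow_succ_log_self (by norm_num) n
  have : Real.logb 2 n ^ C ≤ ((Nat.log 2 n + 1) ^ C : ℕ) := by
    push_cast
    exact pow_le_pow_left₀ h0 (by exact_mod_cast hlt.le) C
  exact (Nat.floor_le_floor this).trans (by rw [Nat.floor_natCast])

/-- **The size criterion.** If `S ≤ n² · 2^q`, `n ≥ 3` and `(d+1)(q+2) ≤ log₂ n` then
`S ≤ ⌈(n choose 2)^{1 + 1/(d+1)}⌉₊`: indeed `n² ≤ 3 (n choose 2)`, and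
`2^{q+2} ≤ 2^{log₂ n/(d+1)} ≤ (n choose 2)^{1/(d+1)}`. [folklore] -/
theorem le_ceil_choose_two_rpow {S n q d : ℕ} (hS : S ≤ n ^ 2 * 2 ^ q) (hn : 3 ≤ n)
    (hq : (d + 1) * (q + 2) ≤ Nat.log 2 n) :
    S ≤ ⌈((n.choose 2 : ℕ) : ℝ) ^ (1 + 1 / ((d : ℝ) + 1))⌉₊ := by
  set m := n.choose 2 with hm
  have hm2 : n ^ 2 ≤ 3 * m := by
    rw [hm, Nat.choose_two_right]
    have : 2 * (n * (n - 1) / 2) = n * (n - 1) :=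
      Nat.two_mul_div_two_of_even (Nat.even_mul_pred_self n)
    zify [show 1 ≤ n by omega] at this ⊢
    nlinarith
  have hnm : n ≤ m := by nlinarith
  have hmpos : (0 : ℝ) < m := by exact_mod_cast (show 0 < m by omega)
  -- it suffices to compare reals
  suffices h : (S : ℝ) ≤ (m : ℝ) ^ (1 + 1 / ((d : ℝ) + 1)) from
    Nat.cast_le.1 (h.trans (Nat.le_ceil _))
  have hd : (0 : ℝ) < (d : ℝ) + 1 := by positivity
  rw [Real.rpow_add hmpos, Real.rpow_one]
  -- `S ≤ m · 2^{q+2}` in `ℕ`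
  have hS' : (S : ℝ) ≤ m * (2 : ℝ) ^ (q + 2) := by
    have : S ≤ m * 2 ^ (q + 2) := by
      calc S ≤ n ^ 2 * 2 ^ q := hS
        _ ≤ 3 * m * 2 ^ q := Nat.mul_le_mul_right _ hm2
        _ ≤ m * 2 ^ (q + 2) := by rw [pow_add]; nlinarith [Nat.one_le_two_pow (n := q)]
    exact_mod_cast this
  refine hS'.trans (mul_le_mul_of_nonneg_left ?_ hmpos.le)
  -- `2^{q+2} ≤ 2^{log₂ n/(d+1)} ≤ n^{1/(d+1)} ≤ m^{1/(d+1)}`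
  have hq' : ((q + 2 : ℕ) : ℝ) ≤ (Nat.log 2 n : ℝ) * (1 / ((d : ℝ) + 1)) := by
    rw [mul_one_div, le_div_iff₀ hd]
    exact_mod_cast (show (q + 2) * (d + 1) ≤ Nat.log 2 n by rw [mul_comm]; exact hq)
  calc (2 : ℝ) ^ (q + 2) = (2 : ℝ) ^ ((q + 2 : ℕ) : ℝ) := (Real.rpow_natCast 2 (q + 2)).symm
    _ ≤ (2 : ℝ) ^ ((Nat.log 2 n : ℝ) * (1 / ((d : ℝ) + 1))) :=
        Real.rpow_le_rpow_of_exponent_le (by norm_num) hq'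
    _ = ((2 : ℝ) ^ (Nat.log 2 n : ℝ)) ^ (1 / ((d : ℝ) + 1)) := by
        rw [Real.rpow_mul (by norm_num)]
    _ ≤ (m : ℝ) ^ (1 / ((d : ℝ) + 1)) := by
        refine Real.rpow_le_rpow (by positivity) ?_ (by positivity)
        rw [Real.rpow_natCast]
        exact_mod_cast (Nat.pow_log_le_self 2 (by omega)).trans hnm

end Literature.Barriers.PneNP.Locality
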